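import Summits.QuantumFields.BalabanUV.T4Continuum.Spine.NE1p.DressedOutputAnalytic
import Summits.QuantumFields.BalabanUV.T4Continuum.Spine.NE1p.DressedSmallFieldGeometryFaces

/-!
# T⁴ programme, spine estimate NE1′ (node O3b/H2) — THE LAST GENERATION-26 SMALL-FIELD ENDs ON THE POLYMER GEOMETRY OF RECORD:
# N0n's parametric ∕ joint (source, background) analyticity faces and N0m's induction face over a `B13Resummation.Geometry`
# bundle and at the CONSTRUCTED torus geometry `tgeometry 4 N` with the clauses located as numerals (crew row S25)

Cell `pub-balaban`, sub-cell `t4`, BINDER-OWNERS row NE1′ (owner lineage t4-ne1p-p1); NE1′ formalisation crew seat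
`b2b-balaban-t4-ne1p-formalise-leaf-05` (LEAF PROVER 05, generation 8), crew row S25 = the remainder named by crew row S24's
author at its landing («N0n's parametric face + an `attachedPart_locE_le_torus` are one `exact` each if ever wanted — not filed,
cap», `CLAIMS.log` 2026-08-20 14:54:56Z).  ADDITIVE — imports N0n `Spine/NE1p/DressedOutputAnalytic` (p220982) and S24
`Spine/NE1p/DressedSmallFieldGeometryFaces` (p221652; ⇒ N0o `DressedSmallFieldGeometry` p221125 ⇒ N0m, N0j, pv22
`TreeLengthTorusGeometry`) ONLY; THEOREMS ONLY (+ one consistency `example`; 0 `def`, 0 `def … : Prop`); nothing of N0n ∕ N0o ∕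
S24 is restated.

WHY THIS FILE.  After N0o (four faces over a geometry + the μ-part on the torus) and S24 (the (w5) ∕ response ∕ (2.14)-shape ∕
births ENDs over a geometry and on the torus) the small-field ENDs of N0j ∕ N0k ∕ N0l ∕ N0m have forms with NO geometry hypothesis
on the tree's CONSTRUCTED torus geometry — except N0m's induction face on the torus — and N0n's three ENDs have none: §1
`differentiableOn_locE_param` ([Balaban1988RGII] p. 15's analyticity sentence, LOCUS ∕ TYPE, as a kernel implication for ANY
complex normed parameter space), `analytic_and_bounded_locE_param` (the (1.18)-TYPE pair) and §2
`differentiableOn_locE_source_background` (JOINT holomorphy on `ball 0 μ₁ ×ˢ W` — the analyticity half of (w1) for REGENERATED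
generations) still DISPLAY the geometry ∕ sign sockets `hloc` `hreach` `hd` `hK₀` `hν` `hκ₀` `hc` `hb` `h126` `hvol` (`h227` `hX`) =
binder group (B4).  THIS FILE wires them, nothing else — the S24 pattern verbatim:
* §1 over ONE `G : B13Resummation.Geometry D Cube` (pv18's HYPOTHESIS structure; composition = `cammarotaStepWith_of_KP`, footprint
  `G.cubes X₀`, `dX := D.dj X₀`, print's (2.27) constant `c = 5`, `b = 5·r₁`), EXPLICIT `[DecidableEq D.Dom] [DecidableRel G.ι]`:
  `differentiableOn_locE_param_of_geometry`, `analytic_and_bounded_locE_param_of_geometry`,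
  `differentiableOn_locE_source_background_of_geometry` — one `exact` of the N0n END each; `P`, `B`, `W` ARBITRARY.
* §2 at `TreeLengthTorusGeometry.tgeometry 4 N` (pv22; 𝐃_{k+1} = `tsys 4 N`, d_{k+1} = `torusTreeLen`, incompatibility `TTouch`;
  all fields PROVED there), constants LOCATED AS NUMERALS exactly as S24 §2 (N0o `torus_consts` + S24 `K₀_four`: ν = 9,
  κ₀ = 64·log 162, c₁ = 64, K₀ = `B12TreeDecay.K₀ 64 8`): `differentiableOn_locE_param_torus`, `analytic_and_bounded_locE_param_torus`,
  `differentiableOn_locE_source_background_torus`, `attachedPart_locE_le_torus` (N0o `attachedPart_locE_le_geom` = N0m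
  `attachedPart_locE_le` at the torus) — NO geometry hypothesis in any of them.
* §3 one `example`: §2's parametric face at `P = ℂ`, `U = ball 0 μ₁` IS S24's `differentiableOn_locE_torus` statement (one
  currency; N0n's own §2 device one level down).

WHAT STAYS DISPLAYED (binders, by name; NOTHING instantiated on Bałaban's densities): (E1)∕(E2) `hhol` ∕ `hm` in the (joint)
parameter with a PARAMETER-FREE majorant; (B3) `hL3` — ONE (2.38)-SHAPE inequality at the dressed constant (= GAPS G-ne9p2-5, shared
with NE9; a BINDER, never `[cite:`-tagged), affine `A₀ + ϱA₁` for the induction face; `hA`, `hr₁`, the two located clauses, `U` ∕ `W`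
open, `2 ≤ ϱ`, `A₀ ≤ ϱA₁`.  (B4) is discharged BY NAME on pv22's CONSTRUCTED torus geometry; the identification of `tsys 4 N` ∕
`torusTreeLen` with Bałaban's 𝐃_{k+1} ∕ d_{k+1} is pv22's READING (DIVERGENCE D-pv22.3), not asserted here — a statement about typed
SHAPES, not a wall discharge.  The G^c-gauge-invariance and chart-membership parts of (w1) are NOT addressed (as in N0n).
HONEST FRAMING.  Kernel bookkeeping; printed loci ([Balaban1988RGII] p. 15, (2.11) p. 14, (1.26) p. 8, (2.27) ∕ (2.30) p. 18, (2.38)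
p. 20, (2.41) p. 21; [Balaban1987RGI] p. 251, p. 257, (1.18) p. 263) are TYPE ∕ CONTEXT through the imported [cite]-tagged Literature
modules, re-asserted nowhere; ABSOLUTE RULE honoured ([folklore] kernel lemmas only).  NE1′ ⇐ the named binders — NOT printed, NOT
proved; 0 leaves instantiated on Bałaban's densities; spine PROVED 0∕9; count 9 unchanged.  Rung (B)+1 on ONE finite four-torus —
NOT infinite volume, NOT a mass gap, NOT OS on ℝ⁴, NOT Clay.  HONEST DEPENDENCY: continuum YM on T⁴ ⇐ BetaPertH ∧ nine spine
estimates (0/9 proved); BetaPertH ⇐ (D1) ∧ (D4) ∧ CAP+tail; G-an2-4 gates asym, D1 and NE2/3/4.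
-/

noncomputable section
namespace Summit.QuantumFields.BalabanUV.T4Continuum.NE1p.DressedOutputAnalyticFaces
open Metric Set Complex
open scoped BigOperators
open Literature.MathematicalPhysics.QuantumFieldTheory.Balaban1983to89 (LocDomainSys)
open Literature.MathematicalPhysics.QuantumFieldTheory.Balaban1983to89.B13Resummation (locE Geometry)
open Literature.MathematicalPhysics.QuantumFieldTheory.Balaban1983to89.TreeLengthTorus (TPt TDom tsys torusTreeLen)
open Literature.MathematicalPhysics.QuantumFieldTheory.Balaban1983to89.TreeLengthTorusGeometry (TTouch tgeometry)
open Literature.MathematicalPhysics.QuantumFieldTheory.Balaban1983to89.B12TreeDecay (K₀)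
open Summit.QuantumFields.BalabanUV.T4Continuum.NE1p.DressedOutputAnalytic (differentiableOn_locE_param
  analytic_and_bounded_locE_param differentiableOn_locE_source_background)
open Summit.QuantumFields.BalabanUV.T4Continuum.NE1p.DressedSmallFieldGeometry (attachedPart_locE_le_geom torus_consts)
open Summit.QuantumFields.BalabanUV.T4Continuum.NE1p.DressedSmallFieldGeometryFaces (K₀_four differentiableOn_locE_torus)

/-! ## §1 N0n's THREE ENDs OVER A `B13Resummation.Geometry` BUNDLE — the geometry ∕ sign sockets ↦ one bundle, explicit instances -/
section OfGeometry
variable {D : LocDomainSys} {Cube : Type} [DecidableEq Cube] [DecidableEq D.Dom] (G : Geometry D Cube) [DecidableRel G.ι]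
variable {P : Type*} [NormedAddCommGroup P] [NormedSpace ℂ P]

/-- **THE OUTPUT IS HOLOMORPHIC IN ANY PARAMETER IN WHICH THE ACTIVITIES ARE, OVER A POLYMER GEOMETRY** (kernel; N0n
`differentiableOn_locE_param` BY NAME, geometry ∕ sign sockets fed from `G` at the footprint `G.cubes X₀`, `c = 5`, `b = 5·r₁`):
activities complex differentiable in `p ∈ U` (open in ANY complex normed `P`) polymer by polymer under a parameter-free (2.38)-shape
majorant (`hL3`, a BINDER) ⇒ `p ↦ E_p(X₀)` complex differentiable on `U`. [folklore] -/
theorem differentiableOn_locE_param_of_geometry {m : D.Dom → ℝ} {act : P → D.Dom → ℂ} {A R r₁ : ℝ} (X₀ : D.Dom) {U : Set P}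
    (hU : IsOpen U) (hA : 0 ≤ A) (hr₁ : 0 ≤ r₁) (hrate : r₁ + 2 * G.κ₀ + 2 ≤ R)
    (hsmall : A * Real.exp (5 * r₁ + 1) * G.K₀ * G.ν * G.c₁ ≤ 1)
    (hhol : ∀ Z, G.cubes Z ⊆ G.cubes X₀ → DifferentiableOn ℂ (fun p => act p Z) U)
    (hm : ∀ p ∈ U, ∀ Z, G.cubes Z ⊆ G.cubes X₀ → ‖act p Z‖ ≤ m Z)
    (hL3 : ∀ Z, G.cubes Z ⊆ G.cubes X₀ → m Z ≤ A * Real.exp (-(R * D.dj Z))) :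
    DifferentiableOn ℂ (fun p => locE G.ι G.cubes (act p) (G.cubes X₀)) U := by
  haveI : Std.Refl G.ι := ⟨G.ι_refl⟩
  haveI : Std.Symm G.ι := ⟨G.ι_symm⟩
  exact differentiableOn_locE_param G.ι (c := 5) (b := 5 * r₁) hU G.loc G.reach_le D.dj_nonneg hA G.K₀_nonneg G.ν_nonneg
    G.κ₀_nonneg hr₁ (by norm_num) (le_of_eq (by ring)) G.ineq126 G.volBound hrate hsmall hhol hm hL3

/-- **… AND BOUNDED BY THE (2.41) ENVELOPE UNIFORMLY ON `U`, OVER A POLYMER GEOMETRY** (kernel; N0n `analytic_and_bounded_locE_param`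
BY NAME, geometry fed): the (1.18)-TYPE pair «analytic on `U` + bounded by `e·G.ν·G.c₁·G.K₀²·A·e^{−r₁ d(X₀)}` there». [folklore] -/
theorem analytic_and_bounded_locE_param_of_geometry {m : D.Dom → ℝ} {act : P → D.Dom → ℂ} {A R r₁ : ℝ} (X₀ : D.Dom)
    {U : Set P} (hU : IsOpen U) (hA : 0 ≤ A) (hr₁ : 0 ≤ r₁) (hrate : r₁ + 2 * G.κ₀ + 2 ≤ R)
    (hsmall : A * Real.exp (5 * r₁ + 1) * G.K₀ * G.ν * G.c₁ ≤ 1)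
    (hhol : ∀ Z, G.cubes Z ⊆ G.cubes X₀ → DifferentiableOn ℂ (fun p => act p Z) U)
    (hm : ∀ p ∈ U, ∀ Z, G.cubes Z ⊆ G.cubes X₀ → ‖act p Z‖ ≤ m Z)
    (hL3 : ∀ Z, G.cubes Z ⊆ G.cubes X₀ → m Z ≤ A * Real.exp (-(R * D.dj Z))) :
    DifferentiableOn ℂ (fun p => locE G.ι G.cubes (act p) (G.cubes X₀)) U ∧
      ∀ p ∈ U, ‖locE G.ι G.cubes (act p) (G.cubes X₀)‖ ≤
        Real.exp 1 * G.ν * G.c₁ * G.K₀ ^ 2 * A * Real.exp (-(r₁ * D.dj X₀)) := by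
  haveI : Std.Refl G.ι := ⟨G.ι_refl⟩
  haveI : Std.Symm G.ι := ⟨G.ι_symm⟩
  exact analytic_and_bounded_locE_param G.ι (c := 5) (b := 5 * r₁) hU G.loc G.reach_le D.dj_nonneg hA G.K₀_nonneg
    G.c₁_nonneg G.ν_nonneg G.κ₀_nonneg hr₁ (by norm_num) (le_of_eq (by ring)) G.ineq126 G.volBound (G.ineq227 X₀) hrate
    hsmall (G.cubes_nonempty X₀) hhol hm hL3

/-- **JOINT HOLOMORPHY IN (SOURCE, BACKGROUND), OVER A POLYMER GEOMETRY** (kernel; N0n `differentiableOn_locE_source_background` BY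
NAME, geometry fed): parameter space `ℂ × B` (`B` ANY complex normed background space — the TYPE of print's `(𝐔,𝐉)`-space), open set
`ball 0 μ₁ ×ˢ W` (`W` open — the TYPE of `𝐔^c_{k+1}(X, α₀, α₁)`) ⇒ the dressed output is JOINTLY complex differentiable in (μ,
background): the analyticity half of (w1) for REGENERATED generations, from per-polymer data + print-TYPE binders. [folklore] -/
theorem differentiableOn_locE_source_background_of_geometry {B : Type*} [NormedAddCommGroup B] [NormedSpace ℂ B]
    {m : D.Dom → ℝ} {act : ℂ × B → D.Dom → ℂ} {A R r₁ μ₁ : ℝ} (X₀ : D.Dom) {W : Set B} (hW : IsOpen W)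
    (hA : 0 ≤ A) (hr₁ : 0 ≤ r₁) (hrate : r₁ + 2 * G.κ₀ + 2 ≤ R)
    (hsmall : A * Real.exp (5 * r₁ + 1) * G.K₀ * G.ν * G.c₁ ≤ 1)
    (hhol : ∀ Z, G.cubes Z ⊆ G.cubes X₀ → DifferentiableOn ℂ (fun p => act p Z) (ball (0 : ℂ) μ₁ ×ˢ W))
    (hm : ∀ p ∈ ball (0 : ℂ) μ₁ ×ˢ W, ∀ Z, G.cubes Z ⊆ G.cubes X₀ → ‖act p Z‖ ≤ m Z)
    (hL3 : ∀ Z, G.cubes Z ⊆ G.cubes X₀ → m Z ≤ A * Real.exp (-(R * D.dj Z))) :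
    DifferentiableOn ℂ (fun p => locE G.ι G.cubes (act p) (G.cubes X₀)) (ball (0 : ℂ) μ₁ ×ˢ W) := by
  haveI : Std.Refl G.ι := ⟨G.ι_refl⟩
  haveI : Std.Symm G.ι := ⟨G.ι_symm⟩
  exact differentiableOn_locE_source_background G.ι (c := 5) (b := 5 * r₁) hW G.loc G.reach_le D.dj_nonneg hA
    G.K₀_nonneg G.ν_nonneg G.κ₀_nonneg hr₁ (by norm_num) (le_of_eq (by ring)) G.ineq126 G.volBound hrate hsmall hhol hm hL3

end OfGeometry

/-! ## §2 ON THE TORUS OF THE PAPERS — no geometry hypothesis; (B5) located as numerals (S24 §2 pattern) -/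
section Torus
variable {N : ℕ} [NeZero N] {P : Type*} [NormedAddCommGroup P] [NormedSpace ℂ P]

open Classical in
/-- **HOLOMORPHY IN ANY PARAMETER ON THE TORUS — NO GEOMETRY HYPOTHESIS** (kernel; §1 `differentiableOn_locE_param_of_geometry` at
`tgeometry 4 N`, constants located by N0o `torus_consts` + S24 `K₀_four`): `p ↦ E_p(X₀)` complex differentiable on `U`. [folklore] -/
theorem differentiableOn_locE_param_torus {m : (tsys 4 N).Dom → ℝ} {act : P → (tsys 4 N).Dom → ℂ} {A R r₁ : ℝ}
    (X₀ : (tsys 4 N).Dom) {U : Set P} (hU : IsOpen U)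
    (hA : 0 ≤ A) (hr₁ : 0 ≤ r₁) (hrate : r₁ + 2 * (64 * Real.log 162) + 2 ≤ R)
    (hsmall : A * Real.exp (5 * r₁ + 1) * K₀ 64 8 * 9 * 64 ≤ 1)
    (hhol : ∀ Z : (tsys 4 N).Dom, Z.1 ⊆ X₀.1 → DifferentiableOn ℂ (fun p => act p Z) U)
    (hm : ∀ p ∈ U, ∀ Z : (tsys 4 N).Dom, Z.1 ⊆ X₀.1 → ‖act p Z‖ ≤ m Z)
    (hL3 : ∀ Z : (tsys 4 N).Dom, Z.1 ⊆ X₀.1 → m Z ≤ A * Real.exp (-(R * torusTreeLen Z.1))) :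
    DifferentiableOn ℂ (fun p => locE (TTouch (d := 4) (N := N)) (fun Z : (tsys 4 N).Dom => Z.1) (act p) X₀.1) U := by
  obtain ⟨hν, hκ, hc⟩ := torus_consts N
  have hK := K₀_four (N := N)
  exact differentiableOn_locE_param_of_geometry (tgeometry 4 N) (m := m) (act := act) (R := R) X₀ hU hA hr₁
    (by rw [hκ]; exact hrate) (by rw [hK, hν, hc]; exact hsmall) hhol hm hL3

open Classical in
/-- **THE (1.18)-TYPE PAIR ON THE TORUS — NO GEOMETRY HYPOTHESIS** (kernel; §1 `analytic_and_bounded_locE_param_of_geometry` at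
`tgeometry 4 N`): holomorphy on `U` AND `‖E_p(X₀)‖ ≤ e·9·64·K₀(64,8)²·A·e^{−r₁·torusTreeLen X₀}` for every `p ∈ U`. [folklore] -/
theorem analytic_and_bounded_locE_param_torus {m : (tsys 4 N).Dom → ℝ} {act : P → (tsys 4 N).Dom → ℂ} {A R r₁ : ℝ}
    (X₀ : (tsys 4 N).Dom) {U : Set P} (hU : IsOpen U)
    (hA : 0 ≤ A) (hr₁ : 0 ≤ r₁) (hrate : r₁ + 2 * (64 * Real.log 162) + 2 ≤ R)
    (hsmall : A * Real.exp (5 * r₁ + 1) * K₀ 64 8 * 9 * 64 ≤ 1)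
    (hhol : ∀ Z : (tsys 4 N).Dom, Z.1 ⊆ X₀.1 → DifferentiableOn ℂ (fun p => act p Z) U)
    (hm : ∀ p ∈ U, ∀ Z : (tsys 4 N).Dom, Z.1 ⊆ X₀.1 → ‖act p Z‖ ≤ m Z)
    (hL3 : ∀ Z : (tsys 4 N).Dom, Z.1 ⊆ X₀.1 → m Z ≤ A * Real.exp (-(R * torusTreeLen Z.1))) :
    DifferentiableOn ℂ (fun p => locE (TTouch (d := 4) (N := N)) (fun Z : (tsys 4 N).Dom => Z.1) (act p) X₀.1) U ∧
      ∀ p ∈ U, ‖locE (TTouch (d := 4) (N := N)) (fun Z : (tsys 4 N).Dom => Z.1) (act p) X₀.1‖ ≤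
        Real.exp 1 * 9 * 64 * K₀ 64 8 ^ 2 * A * Real.exp (-(r₁ * torusTreeLen X₀.1)) := by
  obtain ⟨hν, hκ, hc⟩ := torus_consts N
  have hK := K₀_four (N := N)
  have h := analytic_and_bounded_locE_param_of_geometry (tgeometry 4 N) (m := m) (act := act) (R := R) X₀ hU hA hr₁
    (by rw [hκ]; exact hrate) (by rw [hK, hν, hc]; exact hsmall) hhol hm hL3
  rw [hν, hc, hK] at h
  exact h

open Classical in
/-- **JOINT HOLOMORPHY IN (SOURCE, BACKGROUND) ON THE TORUS — NO GEOMETRY HYPOTHESIS** (kernel; §1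
`differentiableOn_locE_source_background_of_geometry` at `tgeometry 4 N`): the dressed small-field output on a scale-(k+1) domain `X₀`
of the four-torus is JOINTLY complex differentiable in (μ, background) on `ball 0 μ₁ ×ˢ W` (`W` open in ANY complex normed background
space) modulo ONLY (E1)∕(E2), (B3) `hL3`, the two located clauses and the window. [folklore] -/
theorem differentiableOn_locE_source_background_torus {B : Type*} [NormedAddCommGroup B] [NormedSpace ℂ B]
    {m : (tsys 4 N).Dom → ℝ} {act : ℂ × B → (tsys 4 N).Dom → ℂ} {A R r₁ μ₁ : ℝ} (X₀ : (tsys 4 N).Dom) {W : Set B}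
    (hW : IsOpen W) (hA : 0 ≤ A) (hr₁ : 0 ≤ r₁) (hrate : r₁ + 2 * (64 * Real.log 162) + 2 ≤ R)
    (hsmall : A * Real.exp (5 * r₁ + 1) * K₀ 64 8 * 9 * 64 ≤ 1)
    (hhol : ∀ Z : (tsys 4 N).Dom, Z.1 ⊆ X₀.1 → DifferentiableOn ℂ (fun p => act p Z) (ball (0 : ℂ) μ₁ ×ˢ W))
    (hm : ∀ p ∈ ball (0 : ℂ) μ₁ ×ˢ W, ∀ Z : (tsys 4 N).Dom, Z.1 ⊆ X₀.1 → ‖act p Z‖ ≤ m Z)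
    (hL3 : ∀ Z : (tsys 4 N).Dom, Z.1 ⊆ X₀.1 → m Z ≤ A * Real.exp (-(R * torusTreeLen Z.1))) :
    DifferentiableOn ℂ (fun p => locE (TTouch (d := 4) (N := N)) (fun Z : (tsys 4 N).Dom => Z.1) (act p) X₀.1)
      (ball (0 : ℂ) μ₁ ×ˢ W) := by
  obtain ⟨hν, hκ, hc⟩ := torus_consts N
  have hK := K₀_four (N := N)
  exact differentiableOn_locE_source_background_of_geometry (tgeometry 4 N) (m := m) (act := act) (R := R) X₀ hW hA hr₁
    (by rw [hκ]; exact hrate) (by rw [hK, hν, hc]; exact hsmall) hhol hm hL3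

open Classical in
/-- **THE INDUCTION FACE ON THE TORUS — NO GEOMETRY HYPOTHESIS** (kernel; N0o `attachedPart_locE_le_geom` = N0m `attachedPart_locE_le`
at `tgeometry 4 N`, constants located): along the TABLE-STRENGTH pencil (`2 ≤ ϱ`, AFFINE (2.38)-majorant `A₀ + ϱA₁` = `hL3`, a BINDER,
`A₀ ≤ ϱA₁`) the attached part on a scale-(k+1) torus domain `X₀` is `≤ 4·(e·9·64·K₀(64,8)²)·A₁·e^{−r₁·torusTreeLen X₀}`. [folklore] -/
theorem attachedPart_locE_le_torus {m : (tsys 4 N).Dom → ℝ} {act : ℂ → (tsys 4 N).Dom → ℂ} {A₀ A₁ R r₁ ϱ : ℝ}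
    (X₀ : (tsys 4 N).Dom)
    (hA₀ : 0 ≤ A₀) (hA₁ : 0 ≤ A₁) (hr₁ : 0 ≤ r₁) (hrate : r₁ + 2 * (64 * Real.log 162) + 2 ≤ R)
    (hsmall : (A₀ + ϱ * A₁) * Real.exp (5 * r₁ + 1) * K₀ 64 8 * 9 * 64 ≤ 1)
    (hhol : ∀ Z : (tsys 4 N).Dom, Z.1 ⊆ X₀.1 → DifferentiableOn ℂ (fun s => act s Z) (ball (0 : ℂ) ϱ))
    (hm : ∀ s ∈ ball (0 : ℂ) ϱ, ∀ Z : (tsys 4 N).Dom, Z.1 ⊆ X₀.1 → ‖act s Z‖ ≤ m Z)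
    (hL3 : ∀ Z : (tsys 4 N).Dom, Z.1 ⊆ X₀.1 → m Z ≤ (A₀ + ϱ * A₁) * Real.exp (-(R * torusTreeLen Z.1)))
    (hϱ : 2 ≤ ϱ) (hϱA : A₀ ≤ ϱ * A₁) :
    ‖locE (TTouch (d := 4) (N := N)) (fun Z : (tsys 4 N).Dom => Z.1) (act 1) X₀.1 -
        locE (TTouch (d := 4) (N := N)) (fun Z : (tsys 4 N).Dom => Z.1) (act 0) X₀.1‖ ≤
      4 * (Real.exp 1 * 9 * 64 * K₀ 64 8 ^ 2) * A₁ * Real.exp (-(r₁ * torusTreeLen X₀.1)) := by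
  obtain ⟨hν, hκ, hc⟩ := torus_consts N
  have hK := K₀_four (N := N)
  have h := attachedPart_locE_le_geom (tsys 4 N) (tgeometry 4 N) (m := m) (act := act) (R := R) (b := 5 * r₁) (X₀ := X₀)
    hA₀ hA₁ hr₁ (le_of_eq (by ring)) (by rw [hκ]; exact hrate) (by rw [hK, hν, hc]; exact hsmall) hhol hm hL3 hϱ hϱA
  rw [hν, hc, hK] at h
  exact h

/-! ## §3 Consistency: the source disc is the case `P = ℂ` of §2 — S24's holomorphy face BY NAME -/
open Classical in
/-- §2's `differentiableOn_locE_param_torus` at `P = ℂ`, `U = ball 0 μ₁` proves EXACTLY S24's `differentiableOn_locE_torus` statement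
(both inhabit the same type below): one currency. [folklore] -/
example {m : (tsys 4 N).Dom → ℝ} {act : ℂ → (tsys 4 N).Dom → ℂ} {A R r₁ μ₁ : ℝ} (X₀ : (tsys 4 N).Dom)
    (hA : 0 ≤ A) (hr₁ : 0 ≤ r₁) (hrate : r₁ + 2 * (64 * Real.log 162) + 2 ≤ R)
    (hsmall : A * Real.exp (5 * r₁ + 1) * K₀ 64 8 * 9 * 64 ≤ 1)
    (hhol : ∀ Z : (tsys 4 N).Dom, Z.1 ⊆ X₀.1 → DifferentiableOn ℂ (fun s => act s Z) (ball (0 : ℂ) μ₁))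
    (hm : ∀ s ∈ ball (0 : ℂ) μ₁, ∀ Z : (tsys 4 N).Dom, Z.1 ⊆ X₀.1 → ‖act s Z‖ ≤ m Z)
    (hL3 : ∀ Z : (tsys 4 N).Dom, Z.1 ⊆ X₀.1 → m Z ≤ A * Real.exp (-(R * torusTreeLen Z.1))) :
    (DifferentiableOn ℂ (fun s => locE (TTouch (d := 4) (N := N)) (fun Z : (tsys 4 N).Dom => Z.1) (act s) X₀.1) (ball (0 : ℂ) μ₁)) ∧
      DifferentiableOn ℂ (fun s => locE (TTouch (d := 4) (N := N)) (fun Z : (tsys 4 N).Dom => Z.1) (act s) X₀.1) (ball (0 : ℂ) μ₁) :=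
  ⟨differentiableOn_locE_param_torus X₀ isOpen_ball hA hr₁ hrate hsmall hhol hm hL3,
    differentiableOn_locE_torus X₀ hA hr₁ hrate hsmall hhol hm hL3⟩

end Torus
end Summit.QuantumFields.BalabanUV.T4Continuum.NE1p.DressedOutputAnalyticFaces
end
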